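import Literature.AlgebraicGeometry.Motives.PoincareUniversal.GraphCondition
import Literature.AlgebraicGeometry.Modules.DetClassTensorDualPullback
import Literature.AlgebraicGeometry.Modules.UnitCocyclePresented
import HarnessLib

/-!
# Rigidifications kill the twist: the seesaw sheaf comes from the base iff the graph condition holds (M13, node N2a)

Layer `Literature/AlgebraicGeometry/Motives` ∩ `AbelianVarieties`, namespace `Literature.AlgebraicGeometry.Motives.AbelianVariety`.
THEOREMS ONLY; no definition, no named fact, no instance, no `sorry` (cell `hodgecm-mathlib`, D-0151, programme M13 node N2a =
SPEC stub `stub_M13_2_seesawSheaf_iff_graphCond`; HOME bytes `B-plan/m13-glue/N2a-SeesawSheafIffGraphCond.v1.B-p12g12.lean`).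

**`seesawSheaf_iff_graphCond`** ([MumfordAV1970] §13, proof of the Thm. p. 125, first reduction; [MilneAV2008] I §8,
Thm. 8.9): for the seesaw sheaf `𝓕 = q₁₂^*ℒ ⊗ (q₁₃^*𝒫)^∨` on `A₀ × (T × Â)` (`𝒫` rank one, normalised along `{0} × Â`; `ℒ`
rigidified along `{0} × T`) and any test morphism `u = (u₁, u₂) : S → T × Â` over `ℂ`:
«`(1 × u)^*𝓕 ≅ pr_S^*𝓜` for some rank-one `𝓜` on `S`» ⟺ «`(1 × u₂)^*𝒫 ≅ (1 × u₁)^*ℒ`» (`GraphCond u`).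
Proof in `Ȟ¹(−, 𝒪^×)` (★ `nonempty_iso_iff_detClass_eq`): `[(1 × u)^*𝓕] = [(1 × u₁)^*ℒ]·[(1 × u₂)^*𝒫]⁻¹`
(★ `detClass_pullback_tensorObj_dual`); `⇐` with `𝓜 = 𝒪_S`; `⇒`: the unit section `ε_S = (0, 𝟙) : S → A₀ × S` pulls
`[(1 × u₁)^*ℒ]` and `[(1 × u₂)^*𝒫]` back to `1` (`ℒ.rigid` + ★ `unitSection_baseChange_ofAbelianVariety`; the normalisation of `𝒫`
+ ★ `leftUnitor_inv_comp_unitPoint_one_whiskerRight_comp_whiskerLeft_left`) and `pr_S^*[𝓜]` back to `[𝓜]`, so `[𝓜] = 1`.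
Rank one is the currency throughout (the quasi-coherence of `𝓜`, automatic in print, is neither assumed nor produced).
HC_CM is proved only modulo the 7 printed citations until rung 0 closes.

## References
* [MumfordAV1970] D. Mumford, *Abelian Varieties* (1970), §13 (proof of the Thm. p. 125).
* [MilneAV2008] J. S. Milne, *Abelian Varieties* (2008), I §8 Thm. 8.9 (pp. 37–38).
* [Hartshorne1977] R. Hartshorne, *Algebraic Geometry* (1977), II Ex. 6.8, Prop. 6.12; III Ex. 4.5 (`Pic = Ȟ¹(𝒪^×)`).
-/

noncomputable section

open CategoryTheory CategoryTheory.Limits AlgebraicGeometry MonoidalCategory CartesianMonoidalCategory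
open scoped MonObj

namespace Literature.AlgebraicGeometry.Motives.AbelianVariety

open Literature.AlgebraicGeometry.AbelianSchemes Literature.AlgebraicGeometry.AbelianVarieties
  Literature.AlgebraicGeometry.Modules

/-- `𝟙^* = id` on `Ȟ¹(−, 𝒪^×)`. [folklore] -/
private theorem cechPic_pullback_id {X : Scheme.{0}} (c₀ : CechPic X) : CechPic.pullback (𝟙 X) c₀ = c₀ := by
  obtain ⟨c, rfl⟩ := CechPic.mk_surjective c₀
  have hE := c.isFiniteLocallyFree_lineBundle
  rw [← c.detClass_lineBundle, ← detClass_pullback]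
  exact detClass_eq_of_iso ((Scheme.Modules.pullbackId X).app (lineBundle c)) _ _

section N2a

variable (A₀ : AbelianVariety ℂ) {Θ : CartierDivisor A₀.X.left} (hΘ : Θ.IsAmple)
  (P : (A₀.X ⊗ (A₀.dualOf Θ hΘ).X).left.Modules)
  (T' : SchemeOver ℂ) (ℒ : (AbelianSchemeOver.ofAbelianVariety A₀).RigidifiedLineBundle T'.hom)

/-- **The unit section is natural**: `(0, 𝟙_S) ≫ (A₀ ◁ ψ) = ψ ≫ (0, 𝟙_T)` for any `ψ : S ⟶ T` (★
`leftUnitor_inv_comp_unitPoint_one_whiskerRight`: `(λ_S)⁻¹ ≫ x₀ ▷ S = (1, 𝟙_S)`).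
[cite: MumfordFogartyKirwan1994, Ch. 6 §1 Definition 6.1 (p. 115)] -/
theorem leftUnitor_inv_comp_unitPoint_one_whiskerRight_comp_whiskerLeft_of_hom {S : SchemeOver ℂ} (ψ : S ⟶ T') :
    ((λ_ S).inv ≫ A₀.unitPoint 1 ▷ S) ≫ A₀.X ◁ ψ = ψ ≫ ((λ_ T').inv ≫ A₀.unitPoint 1 ▷ T') := by
  rw [leftUnitor_inv_comp_unitPoint_one_whiskerRight, leftUnitor_inv_comp_unitPoint_one_whiskerRight]
  apply CartesianMonoidalCategory.hom_ext
  · rw [Category.assoc, whiskerLeft_fst, CartesianMonoidalCategory.lift_fst, Category.assoc,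
      CartesianMonoidalCategory.lift_fst, MonObj.comp_one]
  · rw [Category.assoc, whiskerLeft_snd, CartesianMonoidalCategory.lift_snd_assoc, Category.id_comp, Category.assoc,
      CartesianMonoidalCategory.lift_snd, Category.comp_id]

/-- **RIGIDIFICATIONS KILL THE TWIST** (M13 SPEC stub `stub_M13_2_seesawSheaf_iff_graphCond`, v0.1 signature).
For the seesaw sheaf `𝓕 = q₁₂^*ℒ ⊗ (q₁₃^*𝒫)^∨` on `A₀ × (T × Â)` (`𝒫` normalised along `{0} × Â`, `ℒ` rigidified along
`{0} × T`) and any test morphism `u = (u₁, u₂) : S → T × Â` over `ℂ`: `(1 × u)^*𝓕 ≅ pr_S^*𝓜` for SOME rank-one `𝓜` on `S`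
iff `(1 × u₂)^*𝒫 ≅ (1 × u₁)^*ℒ`.  Classes in `Ȟ¹(A₀ × S, 𝒪^×)`: `[(1 × u)^*𝓕] = [(1 × u₁)^*ℒ]·[(1 × u₂)^*𝒫]⁻¹`; the unit
section `ε_S` pulls `[(1 × u₁)^*ℒ]` and `[(1 × u₂)^*𝒫]` back to `1` and `pr_S^*[𝓜]` back to `[𝓜]`, so `[𝓜] = 1`.
[cite: MumfordAV1970, §13 (proof of the Thm. p. 125)] [cite: MilneAV2008, I §8 Thm. 8.9 (pp. 37–38)] -/
theorem seesawSheaf_iff_graphCond (hP1 : HasRank P 1)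
    (hnorm : Nonempty ((Scheme.Modules.pullback (sliceZero A₀ (A₀.dualOf Θ hΘ)).left).obj P ≅
      unitModule (A₀.dualOf Θ hΘ).X.left))
    (S : SchemeOver ℂ) (u : S ⟶ T' ⊗ (A₀.dualOf Θ hΘ).X) :
    (∃ (𝓜 : S.left.Modules) (_ : HasRank 𝓜 1),
        Nonempty ((Scheme.Modules.pullback (A₀.X ◁ u).left).obj (seesawSheaf A₀ hΘ P T' ℒ) ≅
          (Scheme.Modules.pullback (CartesianMonoidalCategory.snd A₀.X S).left).obj 𝓜)) ↔
      GraphCond A₀ hΘ P T' ℒ u := by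
  -- `ℒ.L` read as a module on `(A₀ × T').left` (the same scheme, cartesian-monoidal spelling)
  have hℒ1 : HasRank (X := (A₀.X ⊗ T').left) ℒ.L 1 := ℒ.hasRank_one
  have hℒff : IsFiniteLocallyFree (X := (A₀.X ⊗ T').left) ℒ.L := HasRank.isFiniteLocallyFree' hℒ1
  have hPff := HasRank.isFiniteLocallyFree' hP1
  have hM1 : HasRank ((Scheme.Modules.pullback
      (A₀.X ◁ CartesianMonoidalCategory.fst T' (A₀.dualOf Θ hΘ).X).left).obj ℒ.L) 1 := hasRank_pullback _ hℒ1
  have hN1 : HasRank ((Scheme.Modules.pullback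
      (A₀.X ◁ CartesianMonoidalCategory.snd T' (A₀.dualOf Θ hΘ).X).left).obj P) 1 := hasRank_pullback _ hP1
  have h𝓕f : IsFiniteLocallyFree ((Scheme.Modules.pullback (A₀.X ◁ u).left).obj (seesawSheaf A₀ hΘ P T' ℒ)) :=
    isFiniteLocallyFree_pullback_tensorObj_dual _ hM1 hN1
  have h𝓕1 : HasRank ((Scheme.Modules.pullback (A₀.X ◁ u).left).obj (seesawSheaf A₀ hΘ P T' ℒ)) 1 :=
    hasRank_pullback_tensorObj_dual _ hM1 hN1
  -- the two restriction maps `1 × u₂`, `1 × u₁` of `GraphCond` ARE `(A₀ ◁ u) ≫ (A₀ ◁ pr₂)`, `(A₀ ◁ u) ≫ (A₀ ◁ pr₁)`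
  have hk₁ : (AbelianSchemeOver.ofAbelianVariety A₀).baseChangeToProd
      (AbelianSchemeOver.ofAbelianVariety (A₀.dualOf Θ hΘ)) S.hom (u ≫ CartesianMonoidalCategory.snd _ _).left
      (Over.w (u ≫ CartesianMonoidalCategory.snd _ _)) =
        (A₀.X ◁ u).left ≫ (A₀.X ◁ CartesianMonoidalCategory.snd T' (A₀.dualOf Θ hΘ).X).left := by
    rw [AbelianSchemeOver.baseChangeToProd_ofAbelianVariety_eq_whiskerLeft_left A₀ (A₀.dualOf Θ hΘ)
      (u ≫ CartesianMonoidalCategory.snd _ _), MonoidalCategory.whiskerLeft_comp, Over.comp_left]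
  have hk₂ : restrictAlong A₀ hΘ T' u =
      (A₀.X ◁ u).left ≫ (A₀.X ◁ CartesianMonoidalCategory.fst T' (A₀.dualOf Θ hΘ).X).left := by
    rw [restrictAlong_eq_whiskerLeft_left, MonoidalCategory.whiskerLeft_comp, Over.comp_left]
  -- (I) the class of `(1 × u)^*𝓕` in `Ȟ¹(A₀ × S, 𝒪^×)`
  have hI : detClass h𝓕f =
      CechPic.pullback ((A₀.X ◁ u).left ≫ (A₀.X ◁ CartesianMonoidalCategory.fst T' (A₀.dualOf Θ hΘ).X).left)
          (detClass hℒff) *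
        (CechPic.pullback ((A₀.X ◁ u).left ≫ (A₀.X ◁ CartesianMonoidalCategory.snd T' (A₀.dualOf Θ hΘ).X).left)
          (detClass hPff))⁻¹ := by
    have hA := detClass_pullback_tensorObj_dual (A₀.X ◁ u).left hM1 hN1 h𝓕f
      ((hℒff.pullback (A₀.X ◁ CartesianMonoidalCategory.fst T' (A₀.dualOf Θ hΘ).X).left).pullback (A₀.X ◁ u).left)
      ((hPff.pullback (A₀.X ◁ CartesianMonoidalCategory.snd T' (A₀.dualOf Θ hΘ).X).left).pullback (A₀.X ◁ u).left)
    have hB : detClass ((hℒff.pullback (A₀.X ◁ CartesianMonoidalCategory.fst T' (A₀.dualOf Θ hΘ).X).left).pullback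
        (A₀.X ◁ u).left) =
        CechPic.pullback ((A₀.X ◁ u).left ≫ (A₀.X ◁ CartesianMonoidalCategory.fst T' (A₀.dualOf Θ hΘ).X).left)
          (detClass hℒff) :=
      (detClass_pullback _ _).trans (((congrArg (CechPic.pullback (A₀.X ◁ u).left) (detClass_pullback _ hℒff))).trans
        (CechPic.pullback_comp _ _ _).symm)
    have hC : detClass ((hPff.pullback (A₀.X ◁ CartesianMonoidalCategory.snd T' (A₀.dualOf Θ hΘ).X).left).pullback
        (A₀.X ◁ u).left) =
        CechPic.pullback ((A₀.X ◁ u).left ≫ (A₀.X ◁ CartesianMonoidalCategory.snd T' (A₀.dualOf Θ hΘ).X).left)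
          (detClass hPff) :=
      (detClass_pullback _ _).trans (((congrArg (CechPic.pullback (A₀.X ◁ u).left) (detClass_pullback _ hPff))).trans
        (CechPic.pullback_comp _ _ _).symm)
    exact hA.trans (congrArg₂ (fun a b => a * b⁻¹) hB hC)
  -- (II) the graph condition on classes (term-mode: `GraphCond` unfolds definitionally; no `rw` across the
  -- `ofAbelianVariety`/`⊗` spellings of `A₀ × S`)
  have hII : GraphCond A₀ hΘ P T' ℒ u ↔
      CechPic.pullback ((A₀.X ◁ u).left ≫ (A₀.X ◁ CartesianMonoidalCategory.snd T' (A₀.dualOf Θ hΘ).X).left)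
          (detClass hPff) =
        CechPic.pullback ((A₀.X ◁ u).left ≫ (A₀.X ◁ CartesianMonoidalCategory.fst T' (A₀.dualOf Θ hΘ).X).left)
          (detClass hℒff) := by
    have h0 := nonempty_iso_iff_detClass_eq
      (hasRank_pullback ((AbelianSchemeOver.ofAbelianVariety A₀).baseChangeToProd
        (AbelianSchemeOver.ofAbelianVariety (A₀.dualOf Θ hΘ)) S.hom (u ≫ CartesianMonoidalCategory.snd _ _).left
        (Over.w (u ≫ CartesianMonoidalCategory.snd _ _))) hP1)
      (hasRank_pullback (restrictAlong A₀ hΘ T' u) hℒ1)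
      (hPff.pullback _) (hℒff.pullback _)
    have h1 := detClass_pullback ((AbelianSchemeOver.ofAbelianVariety A₀).baseChangeToProd
        (AbelianSchemeOver.ofAbelianVariety (A₀.dualOf Θ hΘ)) S.hom (u ≫ CartesianMonoidalCategory.snd _ _).left
        (Over.w (u ≫ CartesianMonoidalCategory.snd _ _))) hPff
    have h2 := detClass_pullback (restrictAlong A₀ hΘ T' u) hℒff
    have e1 := congrArg (fun k => CechPic.pullback k (detClass hPff)) hk₁
    have e2 := congrArg (fun k => CechPic.pullback k (detClass hℒff)) hk₂
    refine h0.trans ⟨fun h => ?_, fun h => ?_⟩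
    · exact (e1.symm.trans (h1.symm.trans (h.trans h2))).trans e2
    · exact h1.trans ((e1.trans (h.trans e2.symm)).trans h2.symm)
  -- (III) the unit section `ε_S = (0, 𝟙_S)` kills `pr_S`, `ℒ` and `𝒫`
  have e_snd : ((λ_ S).inv ≫ A₀.unitPoint 1 ▷ S).left ≫ (CartesianMonoidalCategory.snd A₀.X S).left = 𝟙 _ := by
    rw [← Over.comp_left, leftUnitor_inv_comp_unitPoint_one_whiskerRight, CartesianMonoidalCategory.lift_snd, Over.id_left]
  have hℒrig : CechPic.pullback ((λ_ T').inv ≫ A₀.unitPoint 1 ▷ T').left (detClass hℒff) = 1 := by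
    obtain ⟨er⟩ := ℒ.rigid
    have hs2 := unitSection_baseChange_ofAbelianVariety A₀ T'
    have eu := (eqToIso (congrArg (fun k => (Scheme.Modules.pullback k).obj ℒ.L) hs2)).symm ≪≫ er
    exact (detClass_pullback _ hℒff).symm.trans
      ((detClass_eq_of_iso eu (hℒff.pullback _) isFiniteLocallyFree_unitModule).trans (detClass_unitModule_eq_one _))
  have hPrig : CechPic.pullback (sliceZero A₀ (A₀.dualOf Θ hΘ)).left (detClass hPff) = 1 := by
    obtain ⟨en⟩ := hnorm
    exact (detClass_pullback _ hPff).symm.trans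
      ((detClass_eq_of_iso en (hPff.pullback _) isFiniteLocallyFree_unitModule).trans (detClass_unitModule_eq_one _))
  have hIIIℒ : CechPic.pullback ((λ_ S).inv ≫ A₀.unitPoint 1 ▷ S).left
      (CechPic.pullback ((A₀.X ◁ u).left ≫ (A₀.X ◁ CartesianMonoidalCategory.fst T' (A₀.dualOf Θ hΘ).X).left)
        (detClass hℒff)) = 1 := by
    rw [← CechPic.pullback_comp, ← Over.comp_left, ← Over.comp_left, ← MonoidalCategory.whiskerLeft_comp,
      leftUnitor_inv_comp_unitPoint_one_whiskerRight_comp_whiskerLeft_of_hom A₀ T' (u ≫ CartesianMonoidalCategory.fst _ _),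
      Over.comp_left, CechPic.pullback_comp, hℒrig, map_one]
  have hIIIP : CechPic.pullback ((λ_ S).inv ≫ A₀.unitPoint 1 ▷ S).left
      (CechPic.pullback ((A₀.X ◁ u).left ≫ (A₀.X ◁ CartesianMonoidalCategory.snd T' (A₀.dualOf Θ hΘ).X).left)
        (detClass hPff)) = 1 := by
    rw [← CechPic.pullback_comp, ← Over.comp_left, ← MonoidalCategory.whiskerLeft_comp,
      leftUnitor_inv_comp_unitPoint_one_whiskerRight_comp_whiskerLeft_left A₀ (A₀.dualOf Θ hΘ)
        (u ≫ CartesianMonoidalCategory.snd _ _),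
      CechPic.pullback_comp, hPrig, map_one]
  constructor
  · rintro ⟨𝓜, h𝓜1, ⟨φ⟩⟩
    have h𝓜ff := HasRank.isFiniteLocallyFree' h𝓜1
    -- `[(1 × u)^*𝓕] = pr_S^*[𝓜]`
    have hc : detClass h𝓕f = CechPic.pullback (CartesianMonoidalCategory.snd A₀.X S).left (detClass h𝓜ff) := by
      rw [detClass_eq_of_iso φ h𝓕f (h𝓜ff.pullback _), detClass_pullback]
    -- restrict to the unit section: `[𝓜] = 1`
    have h𝓜c : detClass h𝓜ff = 1 := by
      have h := congrArg (CechPic.pullback ((λ_ S).inv ≫ A₀.unitPoint 1 ▷ S).left) hc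
      rw [← CechPic.pullback_comp ((λ_ S).inv ≫ A₀.unitPoint 1 ▷ S).left, e_snd, cechPic_pullback_id, hI, map_mul,
        map_inv, hIIIℒ, hIIIP, inv_one, mul_one] at h
      exact h.symm
    have h1 : detClass h𝓕f = 1 := by rw [hc, h𝓜c, map_one]
    rw [hI, mul_inv_eq_one] at h1
    exact hII.mpr h1.symm
  · intro hg
    refine ⟨unitModule S.left, hasRank_unitModule, ?_⟩
    have heq := hII.mp hg
    have h1 : detClass h𝓕f = 1 := by rw [hI, ← heq, mul_inv_cancel]
    refine (nonempty_iso_iff_detClass_eq h𝓕1 (hasRank_pullback _ hasRank_unitModule) h𝓕f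
      (isFiniteLocallyFree_unitModule.pullback _)).mpr ?_
    rw [h1]
    exact ((detClass_pullback (CartesianMonoidalCategory.snd A₀.X S).left
      (isFiniteLocallyFree_unitModule (X := S.left))).trans
        (by rw [detClass_unitModule_eq_one, map_one])).symm

end N2a

end Literature.AlgebraicGeometry.Motives.AbelianVariety

end
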